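import Summits.HodgeConjecture.HodgeConjecture.Theorems.AnchorTransportVariationalHodgePadicGenericPropagation
import Summits.HodgeConjecture.HodgeConjecture.Theorems.AnchorTransportVariationalHodgePadicDescent
import Literature.AlgebraicGeometry.HodgeTheory.ComplementDeathConstantRationalOpenPieces
import Literature.AlgebraicGeometry.HodgeTheory.GenericFibreClosedSubsetSpreadSmoothBase
import Literature.AlgebraicGeometry.HodgeTheory.SpreadSliceCodimension
import Literature.AlgebraicGeometry.HodgeTheory.QbarFamilyLocalSystem
import Literature.AlgebraicGeometry.HodgeTheory.SupportedHodgeClassesAlgebraic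
import Literature.AlgebraicGeometry.Motives.BaseChangeAlgebraicExtension
import Literature.AlgebraicGeometry.Motives.BaseChangeHomDescent
import Literature.AlgebraicGeometry.Motives.DominantImageUncountable

/-!
# Route AnchorTransport — crux `VariationalHodge` (stmt-HodgeConjecture-1076), line `padic-disc-transport`:
# UNCOUNTABLE PROPAGATION (I: algebraically closed field of definition)

HONEST FRAMING: research route conditional on HC_CM; not a corollary; Q11.4-sentence-2 already refuted in dim ≥ 3.
Helper file on the crux item (nothing here closes it; no definition, no named fact, no `sorry`;
`HC_CM` does not occur). Cell `pub-hodge-ring2`, binder seat `ring2-b03` (gen 32), BINDER-OWNERS row b03.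

The SPREADING HALF of STUB G of the registered skeleton
`Cruxes/VariationalHodge/Lines/padic_disc_transport.lean` — the hypothesis `hU` ("uncountable
propagation") of `Theorems.genericPropagation_isQuasiProjective_of_uncountablePropagation`
(`AnchorTransportVariationalHodgePadicGenericPropagation.lean`), PROVED: for a smooth projective
family `f₀ ⊗_σ ℂ : 𝒳 ⟶ S` base-changed from a countable field `k` along `σ : k →+* ℂ`, over a
smooth irreducible affine curve, with `𝒳` quasi-projective, a global class `A ∈ H²ᵖ(𝒳(ℂ); ℂ)`
algebraic on the fibre over a complex point `s` lying over the generic point of `S₀` is algebraic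
on the fibres over an UNCOUNTABLE set of complex points. This file: the case of an ALGEBRAICALLY
CLOSED countable `k` (`uncountablePropagation_of_isAlgClosed`); the sequel
`AnchorTransportVariationalHodgePadicGenericPropagationQP.lean` removes that hypothesis (step 5
below) and concludes STUB G for quasi-projective total spaces.

The proof is the spreading argument of Voisin (*Hodge Theory II*, §3.3.1) and Charles–Schnell
(2014, proof of Prop. 11.3.11, Lemma 11.3.14), assembled from the tree's bricks:

1. (`uncountablePropagation_of_isAlgClosed`, `k` algebraically closed.) `A|_{𝒳_s}` dies off a
   closed `V ⊆ 𝒳_s` of codimension `≥ p` (`mem_supportedClasses_iff_exists`). Spread `V` to a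
   closed `Z ⊆ 𝒲₀ = 𝒳₀ ×_{S₀} T₀` over a smooth affine integral `T₀` dominating `S₀`, with a
   complex point `t` of `T = T₀ ⊗ ℂ` over the generic point of `T₀`, `h(t) = s`, `𝒲_t ≅ 𝒳_s`
   carrying the slice `Z_t` to `V` (`exists_spread_isClosed_fiberOver_generic_smooth`, EGA IV₃ 8
   limit descent). `T` is irreducible (`k = k̄`, `irreducibleSpace_baseChangeHom_left`).
2. Death of `q^*A` off the `k`-closed `Z` is constant over the complex points of `T` above a
   `k`-rational open `O₀ ∋ η_{T₀}` (`map_fiberι_mem_ker_restrictCompl_iff_of_baseChangeHom'`: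
   log resolution and generic smoothness of the snc strata over `k`, Ehresmann relative to the
   boundary, openness and closedness of death on the fibres of a locally trivial fibration); `t`
   lies above `O₀`, and `q^*A|_{𝒲_t}` dies off `Z_t` (transport from `V`).
3. The codimension condition on the slices `Z_y` is the trace of a Zariski open `O_c ⊆ T`
   containing `t` (`exists_opens_pt_mem_iff_forall_height_fiber_add_le`: projective dimension
   theorem in the fibres). So for every complex `y` of `T` above `O₀` and in `O_c`, `A|_{𝒳_{h(y)}}`
   is algebraic (`map_fiberι_mem_algebraicClasses_of_slice`).
4. `h : T → S` is dominant (a point of `T = T₀ ×_{S₀} S` over `(η_{T₀}, η_S)`), so the image of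
   the complex points of the non-empty open `π_T⁻¹O₀ ∩ O_c` is uncountable
   (`ComplexPoints.not_countable_image_of_isDominant_of_smoothCurve`, Baire).
5. (`uncountablePropagation`, any countable `k`.) Replace `k` by its algebraic closure `k̄ ↪ ℂ`
   (`exists_countable_isAlgClosed_factor`): `f₀ ⊗_σ ℂ ≅ (f₀ ⊗ k̄) ⊗ ℂ` as families
   (`baseChangeHomObjIsoOfComp_comm`), every hypothesis and the conclusion transport along the
   isomorphism (`AnchorTransportVariationalHodgePadicDescent`, §ArrowIso/§Complex), and `s` stays
   over the generic point of `S₀ ⊗ k̄` (`eq_genericPoint_of_baseChangeHomFst_eq`: incomparability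
   along the integral projection `S₀ ⊗ k̄ → S₀`).

What is NOT here: STUB G for NON-quasi-projective total spaces (proper non-projective `𝒳`; the
tree's algebraicity-locus structure theorem and the projective dimension theorem on slices both use
an embedding `𝒳 ↪ ℙᴺ`).

References: [VoisinHodgeII2003] §3.3.1; [CharlesSchnell2014Notes] Prop. 11.3.11 (proof),
Lemma 11.3.14, Remark after Cor. 11.3.16; [Voisin2007HodgeLoci] §0, §3; [Lang1958IAG] III §5.
-/

noncomputable section

-- every declaration of this problem lives in `Summit.HodgeConjecture.HodgeConjecture.…` (summit = sub-problem)
set_option linter.dupNamespace false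

open CategoryTheory CategoryTheory.Limits AlgebraicGeometry TopologicalSpace
open Literature.AlgebraicGeometry.Motives Literature.AlgebraicGeometry.HodgeTheory

namespace Summit.HodgeConjecture.HodgeConjecture.Theorems

/-! ### Small helpers -/

section Helpers

/-- Quasi-projectivity over `ℂ` is invariant under isomorphisms (an isomorphism followed by an
open immersion into a projective scheme is an open immersion into it). [folklore] -/
theorem isQuasiProjectiveOver_of_iso {X X' : SchemeOver ℂ} (e : X' ≅ X)
    (h : IsQuasiProjectiveOver X) : IsQuasiProjectiveOver X' := by
  obtain ⟨P, j, hP, hj⟩ := h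
  haveI := hj
  haveI : IsIso e.hom.left := (inferInstance : IsIso ((Over.forget _).mapIso e).hom)
  refine ⟨P, e.hom ≫ j, hP, ?_⟩
  rw [Over.comp_left]
  infer_instance

/-- A complex point of `S₀ ⊗_σ ℂ` whose image in `S₀` is dense lies over the generic point of
`S₀`. [folklore] -/
theorem base_pt_eq_genericPoint_of_closure_eq {k : Type} [Field k] (σ : k →+* ℂ)
    (S₀ : SchemeOver k) [IrreducibleSpace S₀.left] (s : ComplexPoints ((baseChangeHom σ).obj S₀))
    (hs : closure {(baseChangeHomFst σ S₀).base s.pt} = (Set.univ : Set S₀.left)) :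
    baseChangeHomFst σ S₀ s.pt = genericPoint S₀.left := by
  have h : IsGenericPoint (baseChangeHomFst σ S₀ s.pt) (⊤ : Set S₀.left) := hs
  exact h.eq (genericPoint_spec S₀.left)

end Helpers

/-! ### Uncountable propagation, `k` algebraically closed -/

section AlgClosed

/-- **Uncountable propagation for an algebraically closed countable field of definition.** Let
`k` be a countable algebraically closed field, `σ : k →+* ℂ`, `f₀ : 𝒳₀ ⟶ S₀` over `k` whose
complexification `f : 𝒳 ⟶ S` is a smooth projective family of relative dimension `n` over a
smooth irreducible affine curve, `𝒳` quasi-projective, `A ∈ H²ᵖ(𝒳(ℂ); ℂ)` and `s ∈ S(ℂ)` over the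
generic point of `S₀` with `A|_{𝒳_s}` algebraic. Then the set of complex points `t` with
`A|_{𝒳_t}` algebraic is not countable (spread of the support, death constancy over a
`k`-rational open, codimension of the slices, dominant image; module docstring steps 1–4).
[cite: VoisinHodgeII2003, §3.3.1] [cite: CharlesSchnell2014Notes, Prop. 11.3.11 (proof) and Lemma 11.3.14] -/
theorem uncountablePropagation_of_isAlgClosed (k : Type) [Field k] [Countable k] [IsAlgClosed k]
    (σ : k →+* ℂ) ⦃n : ℕ⦄ ⦃𝒳₀ S₀ : SchemeOver k⦄ (f₀ : 𝒳₀ ⟶ S₀)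
    (hf : IsSmoothProjectiveFamily ((baseChangeHom σ).map f₀) n)
    (hirr : IrreducibleSpace ((baseChangeHom σ).obj S₀).left)
    (haff : IsAffine ((baseChangeHom σ).obj S₀).left)
    (hsm : AlgebraicGeometry.Smooth ((baseChangeHom σ).obj S₀).hom)
    (hdim : topologicalKrullDim ((baseChangeHom σ).obj S₀).left = 1)
    (h𝒳 : IsQuasiProjectiveOver ((baseChangeHom σ).obj 𝒳₀))
    (p : ℕ) (A : complexBetti ((baseChangeHom σ).obj 𝒳₀) (2 * p))
    (s : ComplexPoints ((baseChangeHom σ).obj S₀))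
    (hs : closure {(baseChangeHomFst σ S₀).base s.pt} = (Set.univ : Set S₀.left))
    (hA : complexBetti.map (fiberι ((baseChangeHom σ).map f₀) s) (2 * p) A ∈
      algebraicClasses (fiberOver ((baseChangeHom σ).map f₀) s) p) :
    ¬ {t : ComplexPoints ((baseChangeHom σ).obj S₀) |
        complexBetti.map (fiberι ((baseChangeHom σ).map f₀) t) (2 * p) A ∈
          algebraicClasses (fiberOver ((baseChangeHom σ).map f₀) t) p}.Countable := by
  classical
  letI := σ.toAlgebra
  haveI := hirr
  haveI := haff
  haveI := hsm
  haveI : CharZero k := σ.charZero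
  -- ### notation and standing instances
  let 𝒳 : SchemeOver ℂ := (baseChangeHom σ).obj 𝒳₀
  let S : SchemeOver ℂ := (baseChangeHom σ).obj S₀
  let f : 𝒳 ⟶ S := (baseChangeHom σ).map f₀
  let prS : S.left ⟶ S₀.left := baseChangeHomFst σ S₀
  haveI : LocallyOfFiniteType S₀.hom := locallyOfFiniteType_of_smooth_baseChangeHom σ S₀
  haveI : IrreducibleSpace S₀.left := irreducibleSpace_of_baseChangeHom σ S₀
  haveI : IsIntegral S.left := isIntegral_of_irreducibleSpace_of_smooth S
  haveI : IsIntegral S₀.left := isIntegral_of_baseChangeHom σ S₀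
  haveI : SmoothOfRelativeDimension 1 S.hom :=
    Ring2.Hypotheses.smoothOfRelativeDimension_one_of_topologicalKrullDim S hdim
  haveI : IsAffineHom S.hom := isAffineHom_of_isAffine S.hom
  haveI : IsSeparated S.hom := inferInstance
  haveI : IsProper f.left := hf.isProper
  haveI : AlgebraicGeometry.Smooth f.left := hf.smooth
  haveI : IsProper f₀.left := isProper_of_baseChangeHom_map σ f₀
  haveI : AlgebraicGeometry.Smooth f₀.left := smooth_of_baseChangeHom_map σ f₀
  haveI : Surjective prS := (surjective_flat_quasiCompact_baseChangeHomFst σ S₀).1.1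
  -- `s` lies over the generic point
  have hs' : prS s.pt = genericPoint S₀.left := base_pt_eq_genericPoint_of_closure_eq σ S₀ s hs
  -- ### step 1: the support of `A|_{𝒳_s}` and its spread
  obtain ⟨V, hVc, hVp, hV0⟩ := mem_supportedClasses_iff_exists.1 hA
  have hfs : IsSmoothProjective n (fiberOver f s) := hf.isSmoothProjective s
  haveI := IsSmoothProjective.isLocallyNoetherian_holds hfs
  haveI := IsSmoothProjective.compactSpace_holds hfs
  haveI : IsNoetherian (fiberOver f s).left := {}
  have hVcpt : IsCompact Vᶜ := NoetherianSpace.isCompact _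
  obtain ⟨T₀, 𝒲₀, hT₀aff, hT₀int, hT₀sm, h₀, hlft, hdom, g₀, q₀, Z, t, e, Hsq, hZ, hts, hgen,
    hcomp, hslice⟩ := exists_spread_isClosed_fiberOver_generic_smooth σ f₀ s hs' hVc hVcpt
  haveI := hT₀aff
  haveI := hT₀int
  haveI := hlft
  haveI := hdom
  haveI : AlgebraicGeometry.Smooth T₀.hom := hT₀sm
  -- ### instances for the parameter scheme and the spread family
  let T : SchemeOver ℂ := (baseChangeHom σ).obj T₀
  let 𝒲 : SchemeOver ℂ := (baseChangeHom σ).obj 𝒲₀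
  let g : 𝒲 ⟶ T := (baseChangeHom σ).map g₀
  let q : 𝒲 ⟶ 𝒳 := (baseChangeHom σ).map q₀
  let h : T ⟶ S := (baseChangeHom σ).map h₀
  let prT : T.left ⟶ T₀.left := baseChangeHomFst σ T₀
  let prW : 𝒲.left ⟶ 𝒲₀.left := baseChangeHomFst σ 𝒲₀
  haveI : IrreducibleSpace T.left := irreducibleSpace_baseChangeHom_left σ (X := T₀)
  obtain ⟨d, hd⟩ := exists_smoothOfRelativeDimension_of_smooth (f := T₀.hom)
  haveI := hd
  haveI : LocallyOfFiniteType T₀.hom := by rw [← Over.w h₀]; infer_instance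
  haveI : IsAffineHom T₀.hom := isAffineHom_of_isAffine T₀.hom
  haveI : IsSeparated T₀.hom := inferInstance
  haveI : CompactSpace T₀.left := QuasiCompact.compactSpace_of_compactSpace T₀.hom
  haveI : IsProper g₀.left := MorphismProperty.of_isPullback (P := @IsProper) Hsq inferInstance
  haveI : AlgebraicGeometry.Smooth g₀.left :=
    MorphismProperty.of_isPullback (P := @AlgebraicGeometry.Smooth) Hsq inferInstance
  haveI : LocallyOfFiniteType T.hom := by
    change LocallyOfFiniteType (pullback.snd T₀.hom (Spec.map (CommRingCat.ofHom σ)))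
    infer_instance
  haveI : IsSeparated T.hom := by
    change IsSeparated (pullback.snd T₀.hom (Spec.map (CommRingCat.ofHom σ)))
    infer_instance
  have HsqC : IsPullback q g f h := isPullback_baseChangeHom_map_of_isPullback' σ Hsq
  -- ### step 2: death constancy over a `k`-rational open
  let A' : complexBetti 𝒲 (2 * p) := complexBetti.map q (2 * p) A
  obtain ⟨O₀, hηO₀, hconst⟩ :=
    map_fiberι_mem_ker_restrictCompl_iff_of_baseChangeHom' σ g₀ (d := d) Z hZ (2 * p) A'
  let Zc : Set 𝒲.left := (prW : 𝒲.left → 𝒲₀.left) ⁻¹' Z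
  have hZc : IsClosed Zc := hZ.preimage prW.continuous
  have hslice' : e.hom.left.base ⁻¹' V = (fiberι g t).left.base ⁻¹' Zc := by
    change ⇑e.hom.left ⁻¹' V = ⇑(fiberι g t).left ⁻¹' (⇑prW ⁻¹' Z)
    rw [hslice, Scheme.Hom.comp_base, TopCat.coe_comp, Set.preimage_comp]
  have htO₀ : prT t.pt ∈ O₀ := by
    change baseChangeHomFst σ T₀ t.pt ∈ O₀
    rw [hgen]; exact hηO₀
  -- death at `t`
  have hdeath_t : complexBetti.restrictCompl (fiberOver g t) ((fiberι g t).left.base ⁻¹' Zc) (2 * p)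
      (complexBetti.map (fiberι g t) (2 * p) A') = 0 :=
    restrictCompl_map_fiberι_map_eq_zero_of_fiberIso f q g e hcomp hslice' A hV0
  -- ### step 3: the codimension open
  obtain ⟨P, j, hP, hj⟩ := h𝒳
  obtain ⟨N, ι, hι⟩ := hP
  haveI := hj
  haveI := hι
  let ε : 𝒳 ⟶ projectiveSpace N ℂ := j ≫ ι
  haveI hεpre : IsPreimmersion ε.left := by
    change IsPreimmersion (j ≫ ι).left
    rw [Over.comp_left]
    infer_instance
  obtain ⟨Oc, hOc⟩ := exists_opens_pt_mem_iff_forall_height_fiber_add_le f h q g ε HsqC hZc p n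
  have htOc : t.pt ∈ (Oc : Set T.left) :=
    (hOc t).2 (fun z hz => forall_height_add_le_of_fiberIso f g hfs e hslice' hVp z hz)
  -- algebraicity over the good complex points of `T`
  have hgood : ∀ y : ComplexPoints T, prT y.pt ∈ O₀ → y.pt ∈ (Oc : Set T.left) →
      complexBetti.map (fiberι f (AlgPoints.map h y)) (2 * p) A ∈
        algebraicClasses (fiberOver f (AlgPoints.map h y)) p := by
    intro y hyO hyc
    have hdeath_y : complexBetti.restrictCompl (fiberOver g y) ((fiberι g y).left.base ⁻¹' Zc) (2 * p)
        (complexBetti.map (fiberι g y) (2 * p) A') = 0 :=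
      LinearMap.mem_ker.1 ((hconst t y htO₀ hyO).1 (LinearMap.mem_ker.2 hdeath_t))
    exact map_fiberι_mem_algebraicClasses_of_slice f h q g HsqC y (hf.isSmoothProjective _) hZc A
      hdeath_y ((hOc y).1 hyc)
  -- ### step 4: `h` is dominant, and the image of the good points is uncountable
  haveI : IsDominant h.left := by
    have Hh : IsPullback prT h.left h₀.left prS := (isPullback_baseChange_map_left ℂ h₀).flip
    have hT₀ : h₀.left (genericPoint T₀.left) = genericPoint S₀.left :=
      genericPoint_eq_of_isDominant' h₀.left
    have hS : prS (genericPoint S.left) = genericPoint S₀.left := genericPoint_eq_of_isDominant' prS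
    obtain ⟨z, -, hz⟩ := Scheme.Pullback.exists_preimage_pullback (f := h₀.left) (g := prS)
      (genericPoint T₀.left) (genericPoint S.left) (by rw [hT₀, hS])
    refine isDominant_of_apply_eq_genericPoint h.left (v := Hh.isoPullback.inv z) ?_
    rw [← Scheme.Hom.comp_apply, IsPullback.isoPullback_inv_snd]
    exact hz
  let O' : T.left.Opens := (prT ⁻¹ᵁ O₀) ⊓ Oc
  have hO' : ∃ x : ComplexPoints T, x.pt ∈ O' := ⟨t, htO₀, htOc⟩
  have hunc := ComplexPoints.not_countable_image_of_isDominant_of_smoothCurve h O' hO'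
  intro hcount
  apply hunc
  refine hcount.mono ?_
  rintro u ⟨y, hy, rfl⟩
  exact hgood y hy.1 hy.2

end AlgClosed

end Summit.HodgeConjecture.HodgeConjecture.Theorems

end
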